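import Literature.Probability.RandomPlanarGeometry.SAWCountZdFiniteDifferences
import HarnessLib

/-!
# NEWTON CONGRUENCES IN THE DIMENSION: the counts of the dimensions `< m` determine `c_n(ℤ^d)` (and every cost cell `N_{c,n}(ℤ^{d+1})`)
# modulo `2^m · d(d−1)⋯(d−m+1)`

Topic `Literature/Probability/RandomPlanarGeometry` (continues `SAWCountZdFiniteDifferences.lean`: `fwdDiff_iter_costCoeffZd_apply_zero` (`Δ^k_d N_{c,n}(ℤ^{d+1})|_0 = F_{c,n}(k)`),
with `SAWPulledLargeForceExpansionZdHyperoctahedral.two_pow_mul_factorial_dvd_card_allAxesClass` (`2^k k! ∣ F_{c,n}(k)`), `SAWIrreducibleBridgeSpanOne.costCoeffZd_self_succ`,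
`SAWRatioLimit.count_one_eq_two`, `costCoeffZd_zero_dim_eq_zero`, and Mathlib's Gregory–Newton formula `shift_eq_sum_fwdDiff_iter`, `Nat.descFactorial_mul_descFactorial`).

PRINTED CONTEXT (locators only). Clisby–Liang–Slade (2007) §3.3 eqs. (29)/(31); Madras–Slade (1993) §1.1 eq. (1.1.8) p. 5, Appendix C; Graham (2010) §4. NOT IN PRINT
(lane statements): Gregory–Newton interpolation `N(d) = Σ_k C(d,k) Δ^k N(0)` together with `2^k·k! ∣ Δ^k N(0)` gives, for every `m`, that the `k ≥ m` terms are
multiples of `2^k d^{(k)}`, hence of `2^m d^{(m)}`: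

* `two_pow_mul_descFactorial_dvd_choose_mul_fwdDiff_iter_costCoeffZd` — `2^m d^{(m)} ∣ C(d,k)·Δ^k_d N_{c,n}|_0` for `k ≥ m`;
* ★★★ `two_pow_mul_descFactorial_dvd_costCoeffZd_sub_sum` — **`2^m·d^{(m)} ∣ N_{c,n}(ℤ^{d+1}) − Σ_{k<m} C(d,k)·Δ^k_d N_{c,n}(ℤ^{•+1})|_0`** for all `c, n, d, m`;
* ★★★ `two_pow_mul_descFactorial_dvd_count_sub_sum` — **`2^m·d^{(m)} ∣ c_n(ℤ^d) − Σ_{k<m} C(d,k)·Δ^k c_n(ℤ^•)|_0`** for all `n, d, m`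
  (`m = 2`: `c_n(ℤ^d) ≡ 2d (mod 4d(d−1))` of `SAWCountZdDimensionCongruence`; `d = m`: the finite-difference divisibility of `SAWCountZdFiniteDifferences`);
* ★★ `dvd_count_sub_newton_three` — **`8·d(d−1)(d−2) ∣ c_n(ℤ^d) − 2d − C(d,2)·(c_n(ℤ²) − 4)`** for every `n ≥ 1` and every `d`: `c_n(ℤ³) ≡ 3c_n(ℤ²) − 6 (mod 48)`,
  `c_n(ℤ⁴) ≡ 6c_n(ℤ²) − 16 (mod 192)`, `c_n(ℤ⁵) ≡ 10c_n(ℤ²) − 30 (mod 480)`. Numerical face (not used): `c₃(ℤ⁴) − 6c₃(ℤ²) + 16 = 392 − 216 + 16 = 192`,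
  `c₄(ℤ⁴) − 6c₄(ℤ²) + 16 = 2696 − 600 + 16 = 11·192`.
[cite: ClisbyLiangSlade2007, §3.3 eqs. (29)/(31)] [cite: MadrasSlade1993, §1.1 eq. (1.1.8) p. 5; Appendix C pp. 396–397] [cite: Graham2010, Section 4]

Provenance: lane «pcv-sawmu», a-p3 g25 (2026-08-28). PURE STD, no data, no definitions.
-/

noncomputable section

open Finset
open scoped BigOperators
open Literature.Probability.LatticeModels
open Literature.Probability.RandomPlanarGeometry.SAW

namespace Literature.Probability.RandomPlanarGeometry.SAW.Zd

/-! ## §11 Newton congruences: `c_n(ℤ^1), …, c_n(ℤ^{m−1})` determine `c_n(ℤ^d)` modulo `2^m·d(d−1)⋯(d−m+1)` -/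

section Newton

/-- Each Newton term beyond the `m`-th is divisible by `2^m·d(d−1)⋯(d−m+1)`: `C(d,k)·Δ^k_d N_{c,n}(ℤ^{d+1})|_0 = 2^k d^{(k)} · G_{c,n}(k)`.
[cite: Graham2010, Section 4] [cite: MadrasSlade1993, §1.1 eq. (1.1.8) p. 5] -/
theorem two_pow_mul_descFactorial_dvd_choose_mul_fwdDiff_iter_costCoeffZd (c n d : ℕ) {m k : ℕ} (hmk : m ≤ k) :
    ((2 ^ m * d.descFactorial m : ℕ) : ℤ) ∣ (d.choose k : ℤ) * (fwdDiff (1 : ℕ))^[k] (fun j : ℕ => (costCoeffZd j c n : ℤ)) 0 := by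
  rw [fwdDiff_iter_costCoeffZd_apply_zero]
  obtain ⟨g, hg⟩ := two_pow_mul_factorial_dvd_card_allAxesClass k c n
  rw [hg]
  -- `C(d,k) · 2^k k! g = 2^k · d^{(k)} · g` and `2^m d^{(m)} ∣ 2^k d^{(k)}`
  have h1 : (d.choose k : ℤ) * ((2 ^ k * k.factorial * g : ℕ) : ℤ) = ((2 ^ k * d.descFactorial k * g : ℕ) : ℤ) := by
    rw [Nat.descFactorial_eq_factorial_mul_choose]; push_cast; ring
  rw [h1]
  have h2 : 2 ^ m * d.descFactorial m ∣ 2 ^ k * d.descFactorial k * g :=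
    dvd_mul_of_dvd_left (mul_dvd_mul (pow_dvd_pow 2 hmk)
      (Dvd.intro_left _ (Nat.descFactorial_mul_descFactorial hmk))) g
  exact_mod_cast h2

/-- ★★★ **THE NEWTON CONGRUENCE FOR THE COST CENSUS**: for all `c, n, d, m`,
`2^m·d(d−1)⋯(d−m+1) ∣ N_{c,n}(ℤ^{d+1}) − Σ_{k<m} C(d,k)·Δ^k_d N_{c,n}(ℤ^{•+1})|_0` — the censuses of the dimensions `< m` (through the differences
`Δ^k|_0 = Σ_j (−1)^{k−j} C(k,j) N_{c,n}(ℤ^{j+1})`) determine `N_{c,n}(ℤ^{d+1})` modulo `2^m·d^{(m)}` (Gregory–Newton + `2^k k! ∣ F_{c,n}(k)`).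
[cite: Graham2010, Section 4] [cite: MadrasSlade1993, §1.1 eq. (1.1.8) p. 5] -/
theorem two_pow_mul_descFactorial_dvd_costCoeffZd_sub_sum (c n d m : ℕ) :
    ((2 ^ m * d.descFactorial m : ℕ) : ℤ) ∣ (costCoeffZd d c n : ℤ) -
      ∑ k ∈ Finset.range m, (d.choose k : ℤ) * (fwdDiff (1 : ℕ))^[k] (fun j : ℕ => (costCoeffZd j c n : ℤ)) 0 := by
  set f : ℕ → ℤ := fun j => (costCoeffZd j c n : ℤ) with hf
  -- Gregory–Newton: `f d = Σ_{k ≤ d} C(d,k) Δ^k f 0`, and the terms with `k > d` vanish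
  have hGN : f d = ∑ k ∈ Finset.range (m + d + 1), (d.choose k : ℤ) * (fwdDiff (1 : ℕ))^[k] f 0 := by
    have h := shift_eq_sum_fwdDiff_iter (1 : ℕ) f d 0
    rw [zero_add, smul_eq_mul, mul_one] at h
    rw [h, ← Finset.sum_range_add_sum_Ico _ (show d + 1 ≤ m + d + 1 by omega)]
    rw [Finset.sum_eq_zero (s := Finset.Ico (d + 1) (m + d + 1)) fun k hk => by
      rw [Nat.choose_eq_zero_of_lt (by have := (Finset.mem_Ico.1 hk).1; omega)]; simp, add_zero]
    exact Finset.sum_congr rfl fun k _ => by rw [nsmul_eq_mul]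
  have hsplit : f d - ∑ k ∈ Finset.range m, (d.choose k : ℤ) * (fwdDiff (1 : ℕ))^[k] f 0 =
      ∑ k ∈ Finset.Ico m (m + d + 1), (d.choose k : ℤ) * (fwdDiff (1 : ℕ))^[k] f 0 := by
    rw [hGN, ← Finset.sum_range_add_sum_Ico _ (show m ≤ m + d + 1 by omega), add_sub_cancel_left]
  show ((2 ^ m * d.descFactorial m : ℕ) : ℤ) ∣ f d - ∑ k ∈ Finset.range m, (d.choose k : ℤ) * (fwdDiff (1 : ℕ))^[k] f 0
  rw [hsplit]
  exact Finset.dvd_sum fun k hk =>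
    two_pow_mul_descFactorial_dvd_choose_mul_fwdDiff_iter_costCoeffZd c n d (Finset.mem_Ico.1 hk).1

/-- ★★★ **THE NEWTON CONGRUENCE FOR THE SAW COUNTS**: for all `n, d, m`,
**`2^m·d(d−1)⋯(d−m+1) ∣ c_n(ℤ^d) − Σ_{k<m} C(d,k)·Δ^k c_n(ℤ^•)|_0`**, `Δ^k c_n(ℤ^•)|_0 = Σ_{j≤k} (−1)^{k−j} C(k,j) c_n(ℤ^j)`: the counts of the
dimensions `< m` determine `c_n(ℤ^d)` modulo `2^m·d^{(m)}` (`m = 2`: `c_n(ℤ^d) ≡ 2d (mod 4d(d−1))`, `SAWCountZdDimensionCongruence`).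
[cite: ClisbyLiangSlade2007, §3.3 eqs. (29)/(31)] [cite: MadrasSlade1993, §1.1 eq. (1.1.8) p. 5] [cite: Graham2010, Section 4] -/
theorem two_pow_mul_descFactorial_dvd_count_sub_sum (n d m : ℕ) :
    ((2 ^ m * d.descFactorial m : ℕ) : ℤ) ∣ (count d n : ℤ) -
      ∑ k ∈ Finset.range m, (d.choose k : ℤ) * (fwdDiff (1 : ℕ))^[k] (fun j : ℕ => (count j n : ℤ)) 0 := by
  have h := two_pow_mul_descFactorial_dvd_costCoeffZd_sub_sum n (n + 1) d m
  simpa only [costCoeffZd_self_succ] using h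

/-- `c_n(ℤ⁰) = 0` for `n ≥ 1`. [folklore] -/
private theorem count_zero_dim_nw {n : ℕ} (hn : 1 ≤ n) : count 0 n = 0 := by
  rw [← costCoeffZd_self_succ, costCoeffZd_zero_dim_eq_zero hn]

/-- ★★ `m = 3`, EVERY `d`: **`8·d(d−1)(d−2) ∣ c_n(ℤ^d) − 2d − C(d,2)·(c_n(ℤ²) − 4)`** (`n ≥ 1`) — the square lattice determines `c_n(ℤ^d)` modulo
`8d(d−1)(d−2)`: `c_n(ℤ³) ≡ 3c_n(ℤ²) − 6 (mod 48)`, `c_n(ℤ⁴) ≡ 6c_n(ℤ²) − 16 (mod 192)` (`n = 3`: `392 − 200 = 192`; `n = 4`: `2696 − 584 = 11·192`),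
`c_n(ℤ⁵) ≡ 10c_n(ℤ²) − 30 (mod 480)`. [cite: MadrasSlade1993, §1.1 eq. (1.1.8) p. 5; Appendix C (exact enumerations)] -/
theorem dvd_count_sub_newton_three {n : ℕ} (hn : 1 ≤ n) (d : ℕ) :
    ((8 * d.descFactorial 3 : ℕ) : ℤ) ∣ (count d n : ℤ) - 2 * (d : ℤ) - (d.choose 2 : ℤ) * ((count 2 n : ℤ) - 4) := by
  have h := two_pow_mul_descFactorial_dvd_count_sub_sum n d 3
  generalize d.descFactorial 3 = D at h ⊢
  simp only [Finset.sum_range_succ, Finset.sum_range_zero, zero_add,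
    fwdDiff_iter_eq_sum_shift, smul_eq_mul, mul_one] at h
  norm_num [Finset.sum_range_succ, Nat.choose, count_zero_dim_nw hn, count_one_eq_two hn] at h
  have e : (count d n : ℤ) - 2 * (d : ℤ) - (d.choose 2 : ℤ) * ((count 2 n : ℤ) - 4) =
      (count d n : ℤ) - ((d : ℤ) * 2 + (d.choose 2 : ℤ) * (-4 + (count 2 n : ℤ))) := by ring
  rw [e]
  exact h

end Newton

end Literature.Probability.RandomPlanarGeometry.SAW.Zd

end
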